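import Mathlib
import Summits.KontsevichZagierPeriods.KontsevichZagierPeriods.Theorems.InverseLandauTateFamilyKernelCurves

/-!
# `TateLifting` (stmt-KontsevichZagierPeriods-9129), line `Sketch` — stub `stub_dimOneUnitKernel`

UNIT-FORM KERNEL. A `ℤ`-combination `Σⱼ mⱼ [ρⱼ]` of unit-form one-dimensional representations
`ρⱼ = [(0,1), pⱼ/qⱼ]` (`pⱼ, qⱼ ∈ ℝ[x]` with real-algebraic coefficients, `qⱼ ≠ 0` on the CLOSED
interval `[0,1]`) with vanishing evaluation is a relation of the Kontsevich–Zagier calculus.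

Proof.
* MERGE. Put `Q = ∏ⱼ qⱼ` and `P = Σⱼ mⱼ pⱼ ∏_{i ≠ j} qᵢ`. Both have real-algebraic coefficients
  (a real polynomial has real-algebraic coefficients iff it lifts to `K[X]`,
  `K = algebraicClosure ℚ ℝ`, and `Polynomial.lifts` is a subsemiring, `DimOne.uk_*`), `Q ≠ 0` on
  `[0,1]`, and `P/Q = Σⱼ mⱼ · pⱼ/qⱼ` point-wise on `[0,1]` (`DimOne.uk_eval_merge`). The honest
  representation `R = [(0,1), P/Q]` exists (`exists_rep_fin_one`), and INTEGER-WEIGHTED INTEGRAND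
  ADDITIVITY (rule 1b, `ap_of_sub_sum_zsmul_mem`) gives `[R] − Σⱼ mⱼ [ρⱼ] ∈ relations`.
* SOUNDNESS (`KZ.relations_le_ker_eval_holds`): `eval [R] = eval (Σⱼ mⱼ [ρⱼ]) = 0`, i.e.
  `∫₀¹ P/Q = 0` (`setIntegral_fin_one_eq`).
* TRANSFER. The dimension-one transfer `algCoeffKernelDimOne` of the landed line
  `TateFamilyKernelCurves` (Hermite reduction over `ℚ̄`, real form on `[0,1]`, Baker splitting from
  the proved `baker_holds`, exact + modulus part, angle part → arcs, arc normalisation, arc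
  scissors) gives `[R] ∈ relations`, hence `Σⱼ mⱼ [ρⱼ] = [R] − ([R] − Σⱼ mⱼ [ρⱼ]) ∈ relations`.

References: M. Kontsevich, D. Zagier, *Periods* (2001), §1.2; A. Baker, *Transcendental number
theory* (1975), Thm 2.1 (through `algCoeffKernelDimOne`).
-/

noncomputable section

open MeasureTheory Set Polynomial
open Literature.NumberTheory.Transcendental
open Literature.ModelTheory.ExponentialFields (IsSemialgebraic isSemialgebraic_univ)

namespace Summit.KontsevichZagierPeriods.InverseLandau

namespace DimOne

/-! ### Algebra of the merge -/

/-- A real polynomial has real-algebraic coefficients iff it lifts to `K[X]` along the embedding of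
`K = algebraicClosure ℚ ℝ` into `ℝ`. [folklore] -/
theorem uk_algCoeff_iff_mem_lifts (f : ℝ[X]) :
    (∀ n, IsAlgebraic ℚ (f.coeff n)) ↔
      f ∈ Polynomial.lifts (algebraMap (algebraicClosure ℚ ℝ) ℝ) := by
  rw [Polynomial.lifts_iff_coeff_lifts]
  refine forall_congr' fun n => ⟨fun h => ⟨⟨f.coeff n, mem_algebraicClosure_iff.2 h⟩, rfl⟩, ?_⟩
  rintro ⟨y, hy⟩
  rw [← hy]
  exact mem_algebraicClosure_iff.1 y.2

/-- The merged denominator `∏ⱼ qⱼ` has real-algebraic coefficients. [folklore] -/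
theorem uk_algCoeff_prod {k : ℕ} (q : Fin k → ℝ[X]) (hq : ∀ j n, IsAlgebraic ℚ ((q j).coeff n)) :
    ∀ n, IsAlgebraic ℚ ((∏ j, q j).coeff n) :=
  (uk_algCoeff_iff_mem_lifts _).2
    (Subsemiring.prod_mem _ fun j _ => (uk_algCoeff_iff_mem_lifts _).1 (hq j))

/-- The merged numerator `Σⱼ mⱼ pⱼ ∏_{i ≠ j} qᵢ` (`mⱼ ∈ ℤ`) has real-algebraic coefficients.
[folklore] -/
theorem uk_algCoeff_sum {k : ℕ} (m : Fin k → ℤ) (p q : Fin k → ℝ[X])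
    (hp : ∀ j n, IsAlgebraic ℚ ((p j).coeff n)) (hq : ∀ j n, IsAlgebraic ℚ ((q j).coeff n)) :
    ∀ n, IsAlgebraic ℚ
      ((∑ j, C ((m j : ℝ)) * p j * ∏ i ∈ Finset.univ.erase j, q i).coeff n) := by
  refine (uk_algCoeff_iff_mem_lifts _).2 (Subsemiring.sum_mem _ fun j _ => ?_)
  refine Subsemiring.mul_mem _
    (Subsemiring.mul_mem _ ?_ ((uk_algCoeff_iff_mem_lifts _).1 (hp j)))
    (Subsemiring.prod_mem _ fun i _ => (uk_algCoeff_iff_mem_lifts _).1 (hq i))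
  exact Polynomial.C'_mem_lifts
    ⟨⟨(m j : ℝ), mem_algebraicClosure_iff.2 (isAlgebraic_int (m j))⟩, rfl⟩

/-- The merged denominator does not vanish where no `qⱼ` vanishes. [folklore] -/
theorem uk_eval_prod_ne_zero {k : ℕ} (q : Fin k → ℝ[X]) (t : ℝ) (ht : ∀ j, (q j).eval t ≠ 0) :
    (∏ j, q j).eval t ≠ 0 := by
  rw [eval_prod]
  exact Finset.prod_ne_zero_iff.2 fun j _ => ht j

/-- **The merge, point-wise**: `(Σⱼ mⱼ pⱼ ∏_{i ≠ j} qᵢ)/(∏ⱼ qⱼ) = Σⱼ mⱼ · pⱼ/qⱼ` wherever no `qⱼ`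
vanishes. [folklore] -/
theorem uk_eval_merge {k : ℕ} (m : Fin k → ℤ) (p q : Fin k → ℝ[X]) (t : ℝ)
    (ht : ∀ j, (q j).eval t ≠ 0) :
    (∑ j, C ((m j : ℝ)) * p j * ∏ i ∈ Finset.univ.erase j, q i).eval t / (∏ j, q j).eval t =
      ∑ j, (m j : ℝ) * ((p j).eval t / (q j).eval t) := by
  have hE : ∀ j, ∏ i, (q i).eval t = (q j).eval t * ∏ i ∈ Finset.univ.erase j, (q i).eval t :=
    fun j => (Finset.mul_prod_erase Finset.univ (fun i => (q i).eval t) (Finset.mem_univ j)).symm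
  simp only [eval_finsetSum, eval_mul, eval_C, eval_prod]
  rw [Finset.sum_div]
  refine Finset.sum_congr rfl fun j _ => ?_
  rw [hE j, mul_div_mul_right _ _ (Finset.prod_ne_zero_iff.2 fun i _ => ht i), mul_div_assoc]

end DimOne

/-- **UNIT-FORM KERNEL** (stub `stub_dimOneUnitKernel` of the line `Sketch` of `TateLifting`, i.e.
the body of `DimOneUnitKernel`). A `ℤ`-combination of unit-form representations `[(0,1), Pⱼ/Qⱼ]`
(`Pⱼ, Qⱼ ∈ ℝ[x]` with real-algebraic coefficients, `Qⱼ ≠ 0` on `[0,1]`) with vanishing evaluation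
is a relation: merge it into ONE unit-form representation `[(0,1), Σ mⱼPⱼ∏_{i≠j}Qᵢ / ∏Qⱼ]` by
integer-weighted integrand additivity (rule 1b), whose integral vanishes by soundness, and apply
the dimension-one transfer `algCoeffKernelDimOne` (`[(0,1), p/q] ∈ relations` for real-algebraic
coefficients, `q ≠ 0` on `[0,1]`, `∫₀¹ p/q = 0`), assembled from Hermite reduction over `ℚ̄`, the
real form, Baker splitting (from `baker_holds`), the exact + modulus part, angle part → arcs, arc
normalisation and arc scissors. [cite: Baker1975, Thm 2.1] -/
theorem tateLifting_dimOneUnitKernel :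
    ∀ (k : ℕ) (m : Fin k → ℤ) (p q : Fin k → Polynomial ℝ) (ρ : Fin k → KZ.IntegralRep 1),
      (∀ j n, IsAlgebraic ℚ ((p j).coeff n)) → (∀ j n, IsAlgebraic ℚ ((q j).coeff n)) →
      (∀ j, ∀ t ∈ Set.Icc (0 : ℝ) 1, (q j).eval t ≠ 0) →
      (∀ j, (ρ j).domain = {x | x 0 ∈ Set.Ioo (0 : ℝ) 1}) →
      (∀ j, Set.EqOn (ρ j).integrand (fun x => (p j).eval (x 0) / (q j).eval (x 0)) (ρ j).domain) →
      KZ.eval (∑ j, m j • KZ.of (ρ j)) = 0 →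
      ∑ j, m j • KZ.of (ρ j) ∈ KZ.relations := by
  intro k m p q ρ hp hq hq0 hρd hρi heval
  classical
  /- Step 1: the merged unit-form fraction `P/Q`. -/
  set P : ℝ[X] := ∑ j, C ((m j : ℝ)) * p j * ∏ i ∈ Finset.univ.erase j, q i with hP_def
  set Q : ℝ[X] := ∏ j, q j with hQ_def
  have hP : ∀ n, IsAlgebraic ℚ (P.coeff n) := DimOne.uk_algCoeff_sum m p q hp hq
  have hQ : ∀ n, IsAlgebraic ℚ (Q.coeff n) := DimOne.uk_algCoeff_prod q hq
  have hQ0 : ∀ t ∈ Set.Icc (0 : ℝ) 1, Q.eval t ≠ 0 := fun t ht =>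
    DimOne.uk_eval_prod_ne_zero q t fun j => hq0 j t ht
  have hmerge : ∀ t ∈ Set.Icc (0 : ℝ) 1,
      P.eval t / Q.eval t = ∑ j, (m j : ℝ) * ((p j).eval t / (q j).eval t) := fun t ht =>
    DimOne.uk_eval_merge m p q t fun j => hq0 j t ht
  /- Step 2: the honest representation `R = [(0,1), P/Q]`. -/
  have hD : IsSemialgebraic ℚ {x : Fin 1 → ℝ | x 0 ∈ Set.Ioo (0 : ℝ) 1} :=
    ap_isSemialgebraic_Ioo isAlgebraic_zero isAlgebraic_one
  have hsa : IsSemialgebraicFunOn ℚ {x : Fin 1 → ℝ | x 0 ∈ Set.Ioo (0 : ℝ) 1}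
      (fun x => (fun t => P.eval t / Q.eval t) (x 0)) :=
    (rp_isSemialgebraicFunOn_eval hD hP).div (rp_isSemialgebraicFunOn_eval hD hQ)
      fun x hx => hQ0 _ (Ioo_subset_Icc_self hx)
  have hc : ContinuousOn (fun t => P.eval t / Q.eval t) (Set.Icc 0 1) :=
    P.continuous.continuousOn.div Q.continuous.continuousOn hQ0
  obtain ⟨R, hRd, hRi⟩ := exists_rep_fin_one isAlgebraic_zero isAlgebraic_one hsa hc
  /- Step 3: integer-weighted integrand additivity, `[R] - Σⱼ mⱼ [ρⱼ] ∈ relations`. -/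
  have hsub : KZ.of R - ∑ j, m j • KZ.of (ρ j) ∈ KZ.relations := by
    refine ap_of_sub_sum_zsmul_mem R ρ m (fun j => by rw [hρd j, hRd]) fun x hx => ?_
    have hx' : x 0 ∈ Set.Ioo (0 : ℝ) 1 := by
      rw [hRd] at hx
      exact hx
    show R.integrand x = ∑ j, (m j : ℝ) * (ρ j).integrand x
    rw [hRi]
    show P.eval (x 0) / Q.eval (x 0) = ∑ j, (m j : ℝ) * (ρ j).integrand x
    rw [hmerge (x 0) (Ioo_subset_Icc_self hx')]
    refine Finset.sum_congr rfl fun j _ => ?_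
    rw [hρi j (show x ∈ (ρ j).domain by rw [hρd j]; exact hx')]
  /- Step 4: soundness, `∫₀¹ P/Q = eval [R] = eval (Σⱼ mⱼ [ρⱼ]) = 0`. -/
  have hval : R.value = 0 := by
    have h := KZ.relations_le_ker_eval_holds hsub
    rwa [AddMonoidHom.mem_ker, map_sub, heval, sub_zero, KZ.eval_of] at h
  have hint : ∫ t in (0 : ℝ)..1, P.eval t / Q.eval t = 0 := by
    have h3 : R.value = ∫ t in (0 : ℝ)..1, P.eval t / Q.eval t := by
      rw [← setIntegral_fin_one_eq (fun t => P.eval t / Q.eval t) zero_le_one,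
        KZ.IntegralRep.value, hRd, hRi]
    rw [← h3, hval]
  /- Step 5: the dimension-one transfer and assembly. -/
  have hR : KZ.of R ∈ KZ.relations :=
    algCoeffKernelDimOne P Q hP hQ hQ0 hint R hRd (by rw [hRi]; exact fun x _ => rfl)
  have h := KZ.relations.sub_mem hR hsub
  rwa [sub_sub_cancel] at h

end Summit.KontsevichZagierPeriods.InverseLandau

end
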